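import Summits.QuantumFields.BalabanUV.Beta.GAN24.DirichletBoxTrace

/-!
# `BalabanUV.Beta.GAN24.DirichletBoxTraceSum` — binder row G-an2-4 / (CONV-C), road P2 PART II, module M-T (file 2 of 2): THE SUMMED
# DISCRETE TRACE BOUNDS on a block region (unit b2b-balaban-gan24-p2, gen 22, v1)

HONEST FRAMING (cell contract, verbatim): «discharging `BetaPertH` makes Bałaban's UV stability UNCONDITIONAL — a real constructive-QFT
result; it is NOT the continuum limit and NOT the Clay problem.»  SUPPLIER item «Δ1-BOX-SCALAR» under the T⁴-DAG sub-row
`T4-U1a.S-NE2-D1-DIRICHLET°` (holder: the t4-ne2-p1 lineage, wall `hinj`; owner ruling R20 (c), journal l.13903), memo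
`HOME/b2b-balaban-gan24-p2/gen22/DIRICHLET-BOX-TWOLEVEL.md` step L4.  File 1 (`DirichletBoxTrace`) proved the pointwise trace
inequalities and the first-layer line tiling of a block region; THIS FILE sums them over the boundary:

 * §3 **`trace_fwd_sum_le`** / **`trace_bwd_sum_le`**: for `z` vanishing off `Ω = blockReg n S` (a union of unit blocks of the torus
   `(ℤ/nM)^d`), `Σ_{y ∈ Ω, y−e_μ ∉ Ω} ‖n·z(y)‖² ≤ (2/n)·(‖∂_μz‖² + Σ_{x∈Ω}‖(∂_μᴴ∂_μz)(x)‖²)` and the same for `y + e_μ ∉ Ω` — the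
   boundary values («discrete normal traces») of a zero-extended field are small by `1/n` once its Dirichlet energy and its INTERIOR
   diagonal Hessian are controlled (module M-R supplies the latter on corner-free regions; module M-E pairs coarse and fine traces).

ABSOLUTE RULE (cell, verbatim): «No internally-minted statement may enter as a cited fact. Every hypothesis is either kernel-proved in
this package or a verbatim quotation of a PUBLISHED theorem with page reference. The manuscript(s) under audit are NOT citable for
their own disputed steps — they are the thing under adjudication; programme-internal (2001/route/tribunal) claims are never citable.»
[folklore] finite lattice calculus; nothing printed is a hypothesis.  NOT CLAIMED: NE2, (CONV-C) as a whole, `BetaPertH`, continuum, Clay;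
«not in print; our proof attempt».  HONEST DEPENDENCY: continuum YM on T⁴ ⇐ BetaPertH ∧ nine spine estimates (0/9 proved); BetaPertH ⇐
(D1) ∧ (D4) ∧ CAP+tail; G-an2-4 gates asym, D1 and NE2/3/4.
-/

noncomputable section

open scoped BigOperators ComplexConjugate Matrix
open Finset

namespace Summit.QuantumFields.BalabanUV.Beta.GAN24.DirichletBoxTrace

open Literature.MathematicalPhysics.QuantumFieldTheory.Balaban1983to89.B5Prop11Plancherel (Tor fine unitVec)
open Literature.MathematicalPhysics.QuantumFieldTheory.Balaban1983to89.B5Action121 (sdiff sdiff_mulVec)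
open Literature.MathematicalPhysics.QuantumFieldTheory.Balaban1983to89.B5Prop11Lower (nsq nsq_nonneg)
open Literature.MathematicalPhysics.QuantumFieldTheory.Balaban1983to89.B5Block118 (tstep tstep_zero tstep_succ bpt iota up)
open Literature.MathematicalPhysics.QuantumFieldTheory.Balaban1983to89.B5Blocks16 (blockOf blockOf_bpt bpt_bijective bpt_val)
open Summit.QuantumFields.BalabanUV.Beta.GAN24.DirichletBoxRegularity (Pdir Pdir_mulVec)
open Summit.QuantumFields.BalabanUV.T4Continuum.VectorBlockTrialForm (tstep_add)

variable {d : ℕ}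

section Torus

variable (n : ℕ) [NeZero n] (M : Fin d → ℕ) [hM : ∀ μ, NeZero (M μ)]

/-! ## §3 The summed trace bounds on a block region -/

section Sum

variable (S : Tor M → Prop) [DecidablePred S]

/-- **SUMMED TRACE BOUND, forward boundary**: for `z` vanishing off `Ω = blockReg n S`,
`Σ_{y∈Ω, y−e_μ∉Ω} ‖n·z(y)‖² ≤ (2/n)·(‖∂_μz‖² + Σ_{x∈Ω}‖(∂_μᴴ∂_μz)(x)‖²)`. [folklore] -/
theorem trace_fwd_sum_le (μ : Fin d) (z : Tor (fine n M) → ℂ) (hz : ∀ x, ¬ blockReg n M S x → z x = 0) :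
    ∑ y ∈ univ.filter (fun y : Tor (fine n M) => blockReg n M S y ∧ ¬ blockReg n M S (y - unitVec (fine n M) μ)),
        ‖(n : ℂ) * z y‖ ^ 2
      ≤ (2 / (n : ℝ)) * (nsq (sdiff (fine n M) (n : ℂ) μ *ᵥ z)
          + ∑ x ∈ univ.filter (blockReg n M S), ‖(Pdir (fine n M) (n : ℂ) μ *ᵥ z) x‖ ^ 2) := by
  have hn1 : 1 ≤ n := Nat.pos_of_ne_zero (NeZero.ne n)
  have hnR : (0 : ℝ) < n := by exact_mod_cast hn1
  set D := sdiff (fine n M) (n : ℂ) μ with hD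
  set P := Pdir (fine n M) (n : ℂ) μ with hP
  -- the density `H = |∂z(· − e)|² + 𝟙_Ω |Pz|²`
  set G : Tor (fine n M) → ℝ := fun x => if blockReg n M S x then ‖(P *ᵥ z) x‖ ^ 2 else 0 with hG
  have hG0 : ∀ x, 0 ≤ G x := fun x => by simp only [hG]; split_ifs <;> positivity
  set H : Tor (fine n M) → ℝ := fun x => ‖(D *ᵥ z) (x - unitVec (fine n M) μ)‖ ^ 2 + G x with hH
  have hH0 : ∀ x, 0 ≤ H x := fun x => by simp only [hH]; have := hG0 x; positivity
  set B := univ.filter (fun y : Tor (fine n M) => blockReg n M S y ∧ ¬ blockReg n M S (y - unitVec (fine n M) μ)) with hBdef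
  -- pointwise bound at a forward boundary point
  have hpt : ∀ y ∈ B, ‖(n : ℂ) * z y‖ ^ 2 ≤ (2 / (n : ℝ)) * ∑ i ∈ range n, H (y + tstep (fine n M) μ i) := by
    intro y hy
    obtain ⟨hy1, hy2⟩ := (Finset.mem_filter.mp hy).2
    have hval : (D *ᵥ z) (y - unitVec (fine n M) μ) = (n : ℂ) * z y := by
      rw [hD, sdiff_mulVec, sub_add_cancel, hz _ hy2, sub_zero]
    rw [← hval]
    refine (trace_sq_le_fwd n M hn1 μ z y).trans (mul_le_mul_of_nonneg_left ?_ (by positivity))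
    have hdvd := dvd_of_boundary_fwd n M S hy1 hy2
    rw [hH]
    simp only [Finset.sum_add_distrib]
    refine add_le_add (le_of_eq (Finset.sum_congr rfl fun j _ => by rw [add_sub_right_comm])) ?_
    calc ∑ i ∈ range (n - 1), ‖(P *ᵥ z) (y + tstep (fine n M) μ i)‖ ^ 2
        = ∑ i ∈ range (n - 1), G (y + tstep (fine n M) μ i) := by
          refine Finset.sum_congr rfl fun i hi => ?_
          have hi' : i < n := by have := Finset.mem_range.mp hi; omega
          simp only [hG, if_pos (blockReg_add_tstep n M S hy1 hdvd hi')]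
      _ ≤ ∑ i ∈ range n, G (y + tstep (fine n M) μ i) :=
          Finset.sum_le_sum_of_subset_of_nonneg (Finset.range_subset_range.mpr (Nat.sub_le n 1)) (fun i _ _ => hG0 _)
  have hsub : B ⊆ univ.filter (fun y : Tor (fine n M) => n ∣ (y μ).val) := by
    intro y hy
    obtain ⟨hy1, hy2⟩ := (Finset.mem_filter.mp hy).2
    exact Finset.mem_filter.mpr ⟨Finset.mem_univ _, dvd_of_boundary_fwd n M S hy1 hy2⟩
  have htot : ∑ x, H x = nsq (D *ᵥ z) + ∑ x ∈ univ.filter (blockReg n M S), ‖(P *ᵥ z) x‖ ^ 2 := by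
    rw [hH]
    simp only [Finset.sum_add_distrib]
    congr 1
    · rw [nsq]
      exact Fintype.sum_equiv (Equiv.subRight (unitVec (fine n M) μ)) _ _ (fun _ => rfl)
    · rw [Finset.sum_filter]
  calc ∑ y ∈ B, ‖(n : ℂ) * z y‖ ^ 2 ≤ ∑ y ∈ B, (2 / (n : ℝ)) * ∑ i ∈ range n, H (y + tstep (fine n M) μ i) :=
        Finset.sum_le_sum hpt
    _ = (2 / (n : ℝ)) * ∑ y ∈ B, ∑ i ∈ range n, H (y + tstep (fine n M) μ i) := by rw [Finset.mul_sum]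
    _ ≤ (2 / (n : ℝ)) * ∑ x, H x := mul_le_mul_of_nonneg_left (sum_lines_le_of_subset n M μ hsub hH0) (by positivity)
    _ = _ := by rw [htot]

/-- **SUMMED TRACE BOUND, backward boundary**: for `z` vanishing off `Ω = blockReg n S`,
`Σ_{y∈Ω, y+e_μ∉Ω} ‖n·z(y)‖² ≤ (2/n)·(‖∂_μz‖² + Σ_{x∈Ω}‖(∂_μᴴ∂_μz)(x)‖²)`. [folklore] -/
theorem trace_bwd_sum_le (μ : Fin d) (z : Tor (fine n M) → ℂ) (hz : ∀ x, ¬ blockReg n M S x → z x = 0) :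
    ∑ y ∈ univ.filter (fun y : Tor (fine n M) => blockReg n M S y ∧ ¬ blockReg n M S (y + unitVec (fine n M) μ)),
        ‖(n : ℂ) * z y‖ ^ 2
      ≤ (2 / (n : ℝ)) * (nsq (sdiff (fine n M) (n : ℂ) μ *ᵥ z)
          + ∑ x ∈ univ.filter (blockReg n M S), ‖(Pdir (fine n M) (n : ℂ) μ *ᵥ z) x‖ ^ 2) := by
  have hn1 : 1 ≤ n := Nat.pos_of_ne_zero (NeZero.ne n)
  have hnR : (0 : ℝ) < n := by exact_mod_cast hn1
  set D := sdiff (fine n M) (n : ℂ) μ with hD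
  set P := Pdir (fine n M) (n : ℂ) μ with hP
  set G : Tor (fine n M) → ℝ := fun x => if blockReg n M S x then ‖(P *ᵥ z) x‖ ^ 2 else 0 with hG
  have hG0 : ∀ x, 0 ≤ G x := fun x => by simp only [hG]; split_ifs <;> positivity
  set H : Tor (fine n M) → ℝ := fun x => ‖(D *ᵥ z) x‖ ^ 2 + G x with hH
  have hH0 : ∀ x, 0 ≤ H x := fun x => by simp only [hH]; have := hG0 x; positivity
  set c := tstep (fine n M) μ (n - 1) with hc
  set B := univ.filter (fun y : Tor (fine n M) => blockReg n M S y ∧ ¬ blockReg n M S (y + unitVec (fine n M) μ)) with hBdef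
  -- pointwise bound at a backward boundary point, the line re-read from the first-layer site `y − (n−1)e`
  have hpt : ∀ y ∈ B, ‖(n : ℂ) * z y‖ ^ 2 ≤ (2 / (n : ℝ)) * ∑ i ∈ range n, H ((y - c) + tstep (fine n M) μ i) := by
    intro y hy
    obtain ⟨hy1, hy2⟩ := (Finset.mem_filter.mp hy).2
    have hval : ‖(D *ᵥ z) y‖ = ‖(n : ℂ) * z y‖ := by
      rw [hD, sdiff_mulVec, hz _ hy2, zero_sub, mul_neg, norm_neg]
    rw [← hval]
    refine (trace_sq_le_bwd n M hn1 μ z y).trans (mul_le_mul_of_nonneg_left ?_ (by positivity))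
    have hdvd := dvd_succ_of_boundary_bwd n M S hy1 hy2
    -- re-index `i ↦ n − 1 − i`: `y − i e = (y − c) + (n − 1 − i) e`
    have ere : ∀ i, i < n → y - tstep (fine n M) μ i = (y - c) + tstep (fine n M) μ (n - 1 - i) := by
      intro i hi
      rw [hc, sub_add, sub_right_inj, eq_sub_iff_add_eq, ← tstep_add]
      congr 1; omega
    have hreflect : ∀ (K : Tor (fine n M) → ℝ), ∑ i ∈ range n, K (y - tstep (fine n M) μ i)
        = ∑ i ∈ range n, K ((y - c) + tstep (fine n M) μ i) := by
      intro K
      rw [← Finset.sum_range_reflect (fun i => K ((y - c) + tstep (fine n M) μ i)) n]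
      refine Finset.sum_congr rfl fun i hi => ?_
      rw [ere i (Finset.mem_range.mp hi)]
    rw [hH]
    simp only [Finset.sum_add_distrib]
    rw [← hreflect (fun x => ‖(D *ᵥ z) x‖ ^ 2), ← hreflect G]
    refine add_le_add le_rfl ?_
    calc ∑ i ∈ range (n - 1), ‖(P *ᵥ z) (y - tstep (fine n M) μ i)‖ ^ 2
        = ∑ i ∈ range (n - 1), G (y - tstep (fine n M) μ i) := by
          refine Finset.sum_congr rfl fun i hi => ?_
          have hi' : i < n := by have := Finset.mem_range.mp hi; omega
          simp only [hG, if_pos (blockReg_sub_tstep n M S hy1 hdvd hi')]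
      _ ≤ ∑ i ∈ range n, G (y - tstep (fine n M) μ i) :=
          Finset.sum_le_sum_of_subset_of_nonneg (Finset.range_subset_range.mpr (Nat.sub_le n 1)) (fun i _ _ => hG0 _)
  -- the pulled-back boundary points are distinct first-layer points
  have himg : B.image (fun y => y - c) ⊆ univ.filter (fun y : Tor (fine n M) => n ∣ (y μ).val) := by
    intro y0 hy0
    obtain ⟨y, hy, rfl⟩ := Finset.mem_image.mp hy0
    obtain ⟨hy1, hy2⟩ := (Finset.mem_filter.mp hy).2
    exact Finset.mem_filter.mpr ⟨Finset.mem_univ _, (firstLayer_of_lastLayer n M (dvd_succ_of_boundary_bwd n M S hy1 hy2)).1⟩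
  have htot : ∑ x, H x = nsq (D *ᵥ z) + ∑ x ∈ univ.filter (blockReg n M S), ‖(P *ᵥ z) x‖ ^ 2 := by
    rw [hH]
    simp only [Finset.sum_add_distrib]
    congr 1
    rw [Finset.sum_filter]
  calc ∑ y ∈ B, ‖(n : ℂ) * z y‖ ^ 2 ≤ ∑ y ∈ B, (2 / (n : ℝ)) * ∑ i ∈ range n, H ((y - c) + tstep (fine n M) μ i) :=
        Finset.sum_le_sum hpt
    _ = (2 / (n : ℝ)) * ∑ y0 ∈ B.image (fun y => y - c), ∑ i ∈ range n, H (y0 + tstep (fine n M) μ i) := by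
        rw [Finset.sum_image (fun a _ b _ h => sub_left_injective h), Finset.mul_sum]
    _ ≤ (2 / (n : ℝ)) * ∑ x, H x := mul_le_mul_of_nonneg_left (sum_lines_le_of_subset n M μ himg hH0) (by positivity)
    _ = _ := by rw [htot]

end Sum

end Torus

end Summit.QuantumFields.BalabanUV.Beta.GAN24.DirichletBoxTrace

end
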